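import Mathlib.RingTheory.DiscreteValuationRing.TFAE
import Mathlib.RingTheory.KrullDimension.Basic
import Mathlib.RingTheory.Valuation.ValuationSubring
import Mathlib.Order.KrullDimension
import HarnessLib

/-!
# Coarsenings of a valuation subring and its Krull dimension (folklore bookkeeping)

Topic: `Literature/AlgebraicGeometry/Resolution`. Def-free helper lemmas about a valuation subring `O` of
a field `K` and its coarsenings `O ≤ O₁` (Mathlib: `ValuationSubring.ofPrime` / `idealOfLE`, the order
isomorphism `primeSpectrumOrderEquiv` between primes of `O` and valuation subrings containing `O`), used by
`ShannonValuationRankTwoProof.lean` (discharge of `HeinzerEtAl2015ShannonValuationRankTwo`, cell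
`res-hironaka`, crux `Steer` stmt-ResolutionOfSingularities-16345) and meant for any «rank ≤ 2» bookkeeping:

* `ValuationSubring.not_isField_of_ne_top'` — `O ≠ K` is not a field;
* `ValuationSubring.idealOfLE_eq_maximalIdeal_iff` / `idealOfLE_eq_bot_iff` — the prime below a coarsening is
  `𝔪` iff the coarsening is `O`, and `⊥` iff it is `K`;
* `ValuationSubring.two_le_ringKrullDim_of_lt` — a proper coarsening `O < O₁ ≠ K` forces `dim O ≥ 2`;
* `ValuationSubring.eq_top_of_lt_of_isDiscreteValuationRing` — a DVR has no proper coarsening but `K`;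
* `ValuationSubring.ringKrullDim_le_one_of_forall` / `ringKrullDim_le_two_of_forall` — no proper coarsening
  ⇒ `dim ≤ 1`; all proper coarsenings DVRs ⇒ `dim ≤ 2`;
* `ValuationSubring.valuation_eq_one_of_mem_of_inv_mem` — `z, z⁻¹ ∈ O ⇒ v z = 1`.

[cite: Matsumura1987, §10 (Thm. 10.1 and the correspondence between primes and overrings of a valuation
ring)] — standard; OURS as formalisation.
-/

noncomputable section

namespace Literature.AlgebraicGeometry.Resolution

open IsLocalRing

universe u

section ValuationSubringCounting

variable {K : Type u} [Field K]

/-- A valuation subring different from the whole field is not a field (as a ring): some `x⁻¹ ∈ 𝔪` is a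
non-unit. [cite: Matsumura1987, §10 (p. 71, `K − R = {x | x⁻¹ ∈ 𝔪}`)] -/
theorem ValuationSubring.not_isField_of_ne_top' (O : ValuationSubring K) (hO : O ≠ ⊤) :
    ¬ IsField O := by
  intro hF
  apply hO
  rw [eq_top_iff]
  intro z _
  by_cases hz : z ∈ O
  · exact hz
  · have hz0 : z ≠ 0 := by rintro rfl; exact hz O.zero_mem
    have hinv : z⁻¹ ∈ O := (O.mem_or_inv_mem z).resolve_left hz
    have hne : (⟨z⁻¹, hinv⟩ : O) ≠ 0 := by
      intro h
      have : (z⁻¹ : K) = 0 := congrArg Subtype.val h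
      exact hz0 (inv_eq_zero.mp this)
    obtain ⟨w, hw⟩ := hF.mul_inv_cancel hne
    have hwz : (w : K) = z := by
      have h1 : (z⁻¹ : K) * (w : K) = 1 := by
        have := congrArg Subtype.val hw
        simpa using this
      have := congrArg (fun t => z * t) h1
      simpa [← mul_assoc, mul_inv_cancel₀ hz0] using this
    rw [← hwz]
    exact w.2

/-- The prime of `O` cut out by a coarsening `O ≤ O₁` is the maximal ideal iff `O₁ = O` (Matsumura
Thm. 10.1 (i)–(ii): `R' = R_𝔭` with `𝔭 ≠ 𝔪` for `R ≠ R'`). [cite: Matsumura1987, Thm. 10.1] -/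
theorem ValuationSubring.idealOfLE_eq_maximalIdeal_iff (O O₁ : ValuationSubring K) (h : O ≤ O₁) :
    O.idealOfLE O₁ h = maximalIdeal O ↔ O₁ = O := by
  constructor
  · intro hP
    have := ValuationSubring.ofPrime_idealOfLE O O₁ h
    rw [← this]
    simp only [hP, ValuationSubring.ofPrime_top]
  · rintro rfl
    exact ValuationSubring.idealOfLE_self _

/-- The prime of `O` cut out by a coarsening `O ≤ O₁` is `⊥` iff `O₁` is the whole field (Matsumura
Thm. 10.1 (ii): `R' = R_𝔭`). [cite: Matsumura1987, Thm. 10.1] -/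
theorem ValuationSubring.idealOfLE_eq_bot_iff (O O₁ : ValuationSubring K) (h : O ≤ O₁) :
    O.idealOfLE O₁ h = ⊥ ↔ O₁ = ⊤ := by
  constructor
  · intro hP
    have := ValuationSubring.ofPrime_idealOfLE O O₁ h
    rw [← this]
    simp only [hP, ValuationSubring.ofPrime_bot]
  · rintro rfl
    exact ValuationSubring.idealOfLE_top _

/-- A proper coarsening `O < O₁ ≠ K` forces `dim O ≥ 2` (the chain `⊥ < 𝔪_{O₁} ∩ O < 𝔪_O`, Matsumura
Thm. 10.1 (i)). [cite: Matsumura1987, Thm. 10.1] -/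
theorem ValuationSubring.two_le_ringKrullDim_of_lt (O O₁ : ValuationSubring K) (h₁ : O < O₁)
    (h₂ : O₁ ≠ ⊤) : (2 : WithBot ℕ∞) ≤ ringKrullDim O := by
  have hle : O ≤ O₁ := h₁.le
  set P := O.idealOfLE O₁ hle with hPdef
  have hPbot : (⊥ : Ideal O) < P := by
    refine lt_of_le_of_ne bot_le (fun h => h₂ ?_)
    exact (ValuationSubring.idealOfLE_eq_bot_iff O O₁ hle).mp h.symm
  have hPtop : P < maximalIdeal O := by
    refine lt_of_le_of_ne (IsLocalRing.le_maximalIdeal (Ideal.IsPrime.ne_top inferInstance)) ?_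
    intro h
    exact (ne_of_lt h₁) ((ValuationSubring.idealOfLE_eq_maximalIdeal_iff O O₁ hle).mp h).symm
  -- the chain ⊥ < P < 𝔪 in `PrimeSpectrum O`
  have hlt₁ : (⟨⊥, Ideal.isPrime_bot⟩ : PrimeSpectrum O) < ⟨P, inferInstance⟩ := hPbot
  have hlt₂ : (⟨P, inferInstance⟩ : PrimeSpectrum O) < ⟨maximalIdeal O, inferInstance⟩ := hPtop
  let s : LTSeries (PrimeSpectrum O) :=
    RelSeries.fromListIsChain [⟨⊥, Ideal.isPrime_bot⟩, ⟨P, inferInstance⟩,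
        ⟨maximalIdeal O, inferInstance⟩] (by simp)
      (List.IsChain.cons_cons hlt₁ (List.IsChain.cons_cons hlt₂ (List.isChain_singleton _)))
  have hs : s.length = 2 := by simp [s]
  have := Order.le_krullDim_iff.mpr ⟨s, hs⟩
  simpa [ringKrullDim] using this

/-- A discrete valuation subring has no proper coarsening other than the field (a DVR has Krull
dimension one; Matsumura Thm. 10.1 with Thm. 11.1). [cite: Matsumura1987, Thm. 10.1, Thm. 11.1] -/
theorem ValuationSubring.eq_top_of_lt_of_isDiscreteValuationRing (O₂ O₁ : ValuationSubring K)
    [IsDiscreteValuationRing O₂] (h : O₂ < O₁) : O₁ = ⊤ := by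
  by_contra hne
  have h2 := ValuationSubring.two_le_ringKrullDim_of_lt O₂ O₁ h hne
  rw [IsDiscreteValuationRing.ringKrullDim_eq_one] at h2
  exact absurd h2 (by decide)

/-- If `O` has no proper coarsening other than the field, then `dim O ≤ 1` (every prime `𝔭 ≠ 0, 𝔪`
would give the proper overring `O_𝔭`, Matsumura Thm. 10.1). [cite: Matsumura1987, Thm. 10.1] -/
theorem ValuationSubring.ringKrullDim_le_one_of_forall (O : ValuationSubring K)
    (h : ∀ O₁ : ValuationSubring K, O < O₁ → O₁ = ⊤) : ringKrullDim O ≤ 1 := by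
  suffices hk : Ring.KrullDimLE 1 O by
    have := (Ring.krullDimLE_iff (R := O) (n := 1)).mp hk
    exact_mod_cast this
  refine Ring.KrullDimLE.mk₁' (fun P hP hPprime => ?_)
  -- the coarsening at `P` is proper unless `P = 𝔪`
  by_contra hmax
  have hPne : P ≠ maximalIdeal O := fun h' => hmax (h' ▸ IsLocalRing.maximalIdeal.isMaximal O)
  haveI := hPprime
  have hlt : O < O.ofPrime P := by
    refine lt_of_le_of_ne (O.le_ofPrime P) (fun heq => hPne ?_)
    have := O.idealOfLE_ofPrime P
    rw [← this]
    exact (ValuationSubring.idealOfLE_eq_maximalIdeal_iff O (O.ofPrime P) (O.le_ofPrime P)).mpr heq.symm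
  have htop := h _ hlt
  apply hP
  have := O.idealOfLE_ofPrime P
  rw [← this]
  exact (ValuationSubring.idealOfLE_eq_bot_iff O (O.ofPrime P) (O.le_ofPrime P)).mpr htop

/-- If every proper coarsening of `O` other than the field is a discrete valuation ring, then
`dim O ≤ 2` (a chain of four primes would give two comparable proper overrings `O_𝔭 ⊊ O_𝔮`, the smaller a
DVR — Matsumura Thm. 10.1). [cite: Matsumura1987, Thm. 10.1, Thm. 11.1] -/
theorem ValuationSubring.ringKrullDim_le_two_of_forall (O : ValuationSubring K)
    (h : ∀ O₁ : ValuationSubring K, O < O₁ → O₁ ≠ ⊤ → IsDiscreteValuationRing O₁) :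
    ringKrullDim O ≤ 2 := by
  unfold ringKrullDim Order.krullDim
  refine iSup_le (fun s => ?_)
  by_contra hlen
  have h3 : 3 ≤ s.length := by
    by_contra h'
    apply hlen
    have : s.length ≤ 2 := by omega
    exact_mod_cast this
  -- primes s 1 < s 2 (indices inside the series) give coarsenings O < O₂ < O₁ < ⊤
  have hmono := s.strictMono
  let i1 : Fin (s.length + 1) := ⟨1, by omega⟩
  let i2 : Fin (s.length + 1) := ⟨2, by omega⟩
  let i0 : Fin (s.length + 1) := ⟨0, by omega⟩
  let i3 : Fin (s.length + 1) := ⟨3, by omega⟩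
  have h01 : s i0 < s i1 := hmono (by simp [i0, i1, Fin.lt_def])
  have h12 : s i1 < s i2 := hmono (by simp [i1, i2, Fin.lt_def])
  have h23 : s i2 < s i3 := hmono (by simp [i2, i3, Fin.lt_def])
  set p₁ := (s i1).asIdeal with hp₁
  set p₂ := (s i2).asIdeal with hp₂
  haveI hp₁prime : p₁.IsPrime := (s i1).isPrime
  haveI hp₂prime : p₂.IsPrime := (s i2).isPrime
  have hp₁ne_bot : p₁ ≠ ⊥ := by
    intro hb
    have : (s i0).asIdeal < p₁ := h01
    rw [hb] at this
    exact not_lt_bot this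
  have hp₂ne_top : p₂ ≠ maximalIdeal O := by
    intro ht
    have hlt : p₂ < (s i3).asIdeal := h23
    rw [ht] at hlt
    exact (ne_of_lt hlt) (((IsLocalRing.maximalIdeal.isMaximal O).eq_of_le
      (s i3).isPrime.ne_top hlt.le))
  have hp₁₂ : p₁ < p₂ := h12
  -- the coarsenings
  let O₁ := O.ofPrime p₁
  let O₂ := O.ofPrime p₂
  have hO₂₁ : O₂ ≤ O₁ := ValuationSubring.ofPrime_le_of_le O p₁ p₂ hp₁₂.le
  have hO₂₁ne : O₂ ≠ O₁ := by
    intro heq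
    have h1 := O.idealOfLE_ofPrime p₁
    have h2 := O.idealOfLE_ofPrime p₂
    have : p₂ = p₁ := by
      rw [← h1, ← h2]
      congr 1
    exact (ne_of_lt hp₁₂) this.symm
  have hOO₂ : O < O₂ := by
    refine lt_of_le_of_ne (O.le_ofPrime p₂) (fun heq => hp₂ne_top ?_)
    have := O.idealOfLE_ofPrime p₂
    rw [← this]
    exact (ValuationSubring.idealOfLE_eq_maximalIdeal_iff O O₂ (O.le_ofPrime p₂)).mpr heq.symm
  have hO₁top : O₁ ≠ ⊤ := by
    intro htop
    apply hp₁ne_bot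
    have := O.idealOfLE_ofPrime p₁
    rw [← this]
    exact (ValuationSubring.idealOfLE_eq_bot_iff O O₁ (O.le_ofPrime p₁)).mpr htop
  have hO₂top : O₂ ≠ ⊤ := fun h' => hO₁top (top_le_iff.mp (h' ▸ hO₂₁))
  haveI : IsDiscreteValuationRing O₂ := h O₂ hOO₂ hO₂top
  exact hO₁top (ValuationSubring.eq_top_of_lt_of_isDiscreteValuationRing O₂ O₁
    (lt_of_le_of_ne hO₂₁ hO₂₁ne))

/-- In a valuation subring, a non-zero element with both itself and its inverse inside is a unit, i.e.
has value `1`. [cite: Matsumura1987, §10 (p. 71)] -/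
theorem ValuationSubring.valuation_eq_one_of_mem_of_inv_mem (O₁ : ValuationSubring K) {z : K}
    (hz0 : z ≠ 0) (hz : z ∈ O₁) (hzi : z⁻¹ ∈ O₁) : O₁.valuation z = 1 := by
  have h1 : O₁.valuation z ≤ 1 := (O₁.valuation_le_one_iff z).mpr hz
  have h2 : O₁.valuation z⁻¹ ≤ 1 := (O₁.valuation_le_one_iff _).mpr hzi
  have h3 : O₁.valuation z * O₁.valuation z⁻¹ = 1 := by
    rw [← map_mul, mul_inv_cancel₀ hz0, map_one]
  refine le_antisymm h1 ?_
  calc (1 : _) = O₁.valuation z * O₁.valuation z⁻¹ := h3.symm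
    _ ≤ O₁.valuation z * 1 := by gcongr
    _ = O₁.valuation z := mul_one _

end ValuationSubringCounting

end Literature.AlgebraicGeometry.Resolution

end
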